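import Literature.NumberTheory.QuadraticFields.JacobiCharacter
import Literature.NumberTheory.QuadraticFields.HeegnerCondition
import Mathlib.NumberTheory.LSeries.PrimesInAP
import Literature.NumberTheory.QuadraticFields.KroneckerSplitting
import HarnessLib

/-!
# The value at `2` of the Kronecker character of a quadratic field of odd discriminant, from its
# odd-prime values (PROVED)

Topic `NumberTheory/QuadraticFields`; width seat `bsd-line-cf2-p1-w8` (g25) of the cell
`bsd-print-cf2` (support item stmt-BirchSwinnertonDyer-27325 `PrintCf2.SplitBadTwoDisegniGZPairOfFacts`).
Everything here is PROVED (two theorems, no definitions, no named facts). Companion of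
`KroneckerCharacterOdd.lean` (same method).

Several tree statements about a quadratic field `K` take "its quadratic character" as ANY Dirichlet
character `κ` mod `|d_K|` pinned by its values at the primes: `κ(p) = (d_K/p)` at odd primes `p`
(hypothesis `hoddp`) AND `κ(2) = 1, −1, 0` according as `d_K ≡ 1, 5 (mod 8)` or `d_K` even
(hypothesis `htwo`, e.g. `rankinSelbergEulerProductHecke_baseChangeDirichlet_eq`). Some route items
(e.g. `PrintCf2.SplitBadTwoDisegniGZPairOfFacts`, stmt-BirchSwinnertonDyer-27325) hand over only the
odd-prime values. For ODD `d_K` the value at `2` is DETERMINED by them: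
`kroneckerChar_two_of_discr_odd` derives `htwo` from `hoddp`. Proof (Cox, Lemma 1.14: the Kronecker
symbol `n ↦ (d_K/n)` is a character mod `|d_K|`): `2` is a unit mod `|d_K|`, so by Dirichlet's theorem
(Mathlib `Nat.forall_exists_prime_gt_and_eq_mod`) there is an odd prime `ℓ ≡ 2 (mod |d_K|)`, whence
`κ(2) = κ(ℓ) = (d_K/ℓ) = (ℓ/|d_K|)` (reciprocity for `d_K ≡ 1 (mod 4)`, tree
`jacobiSym_natAbs_eq_of_emod_four_eq_one`) `= (2/|d_K|)` (periodicity in the top argument), which is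
`1` resp. `−1` for `d_K ≡ 1` resp. `5 (mod 8)` (tree `jacobiSym_two_natAbs_eq_one_iff` /
`jacobiSym_two_natAbs_eq_neg_one_iff`). `kroneckerChar_two_of_ncard_primesOver_two` is the case used by
the cell: `2` SPLIT in `K` forces `d_K ≡ 1 (mod 8)` (tree `Quadratic.ncard_primesOver_two_eq_two_iff`),
so `κ(2) = 1`.

## References

* [Cox2013] D. A. Cox, *Primes of the form x² + ny²*, 2nd ed. (2013), §1.C Lemma 1.14 and (1.17)–(1.18).
* [IrelandRosen1990] K. Ireland, M. Rosen, *A Classical Introduction to Modern Number Theory*, 2nd ed.,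
  Prop. 5.2.2 (the supplement `(2/m)`) and Prop. 13.1.4 (decomposition of `2` in quadratic fields).
-/

noncomputable section

open scoped Classical NumberTheorySymbols

namespace Literature.NumberTheory.QuadraticFields

open Literature.NumberTheory.QuadraticFields.Quadratic

/-- **The Kronecker character at `2`, odd discriminant.** For a quadratic field `K` with
`d_K ≡ 1 (mod 4)` and any Dirichlet character `κ` mod `|d_K|` with `κ(p) = (d_K/p)` at the odd
primes `p`: `κ(2) = 1` if `d_K ≡ 1 (mod 8)`, `κ(2) = −1` if `d_K ≡ 5 (mod 8)` (stated in the tree's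
three-way `if` form of the hypothesis `htwo`). Proof: Dirichlet prime `ℓ ≡ 2 (mod |d_K|)`,
`κ(2) = κ(ℓ) = (d_K/ℓ) = (ℓ/|d_K|) = (2/|d_K|)`. [cite: Cox2013, §1.C Lemma 1.14]
[cite: IrelandRosen1990, Prop. 5.2.2] -/
theorem kroneckerChar_two_of_discr_odd {K : Type*} [Field K] [NumberField K]
    (h4 : NumberField.discr K % 4 = 1)
    (κ : DirichletCharacter ℂ (NumberField.discr K).natAbs)
    (hoddp : ∀ p : ℕ, p.Prime → p ≠ 2 → κ p = (jacobiSym (NumberField.discr K) p : ℂ)) :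
    κ 2 = if NumberField.discr K % 8 = 1 then 1
      else if NumberField.discr K % 8 = 5 then -1 else 0 := by
  set D := NumberField.discr K with hDdef
  have hD0 : D ≠ 0 := NumberField.discr_ne_zero K
  have hd0 : D.natAbs ≠ 0 := Int.natAbs_ne_zero.mpr hD0
  haveI : NeZero D.natAbs := ⟨hd0⟩
  have hdodd : Odd D.natAbs := by
    rw [Int.natAbs_odd]
    exact Int.odd_iff.mpr (by omega)
  -- `2` is a unit mod `|D|`; an odd prime `ℓ ≡ 2 (mod |D|)` by Dirichlet's theorem
  have hu : IsUnit (2 : ZMod D.natAbs) := by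
    have h22 : ((2 : ℕ) : ZMod D.natAbs) = 2 := by norm_cast
    rw [← h22, ZMod.isUnit_iff_coprime]
    exact Nat.coprime_two_left.mpr hdodd
  obtain ⟨ℓ, hℓ2, hℓ, hℓmod⟩ := Nat.forall_exists_prime_gt_and_eq_mod hu 2
  have hℓne : ℓ ≠ 2 := by omega
  have hℓodd : Odd ℓ := hℓ.odd_of_ne_two hℓne
  have hcong : (ℓ : ℤ) % (D.natAbs : ℕ) = (2 : ℤ) % (D.natAbs : ℕ) := by
    refine (ZMod.intCast_eq_intCast_iff' (ℓ : ℤ) 2 D.natAbs).mp ?_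
    push_cast
    exact hℓmod
  -- `(D/ℓ) = (ℓ/|D|) = (2/|D|)`
  have key : J(D | ℓ) = J(2 | D.natAbs) := by
    rw [← jacobiSym_natAbs_eq_of_emod_four_eq_one h4 hℓodd, jacobiSym.mod_left (ℓ : ℤ), hcong,
      ← jacobiSym.mod_left]
  rw [← hℓmod, hoddp ℓ hℓ hℓne, key]
  by_cases h81 : D % 8 = 1
  · rw [if_pos h81, (jacobiSym_two_natAbs_eq_one_iff h4).mpr h81, Int.cast_one]
  · have h85 : D % 8 = 5 := by omega
    rw [if_neg h81, if_pos h85, (jacobiSym_two_natAbs_eq_neg_one_iff h4).mpr h85]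
    push_cast
    ring

/-- **The Kronecker character at `2` when `2` splits.** For a quadratic field `K` (`[K:ℚ] = 2`) in
which `2` splits (two primes of `𝓞 K` above `2`, i.e. `d_K ≡ 1 (mod 8)`, tree
`Quadratic.ncard_primesOver_two_eq_two_iff`) and any Dirichlet character `κ` mod `|d_K|` with the
Kronecker values at the odd primes: `κ(2) = 1`, and `κ` satisfies the tree's three-way hypothesis
`htwo`. [cite: Cox2013, §1.C Lemma 1.14] [cite: IrelandRosen1990, Prop. 13.1.4] -/
theorem kroneckerChar_two_of_ncard_primesOver_two {K : Type*} [Field K] [NumberField K]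
    (h2 : Module.finrank ℚ K = 2)
    (hsplit : ((Ideal.span {(2 : ℤ)}).primesOver (NumberField.RingOfIntegers K)).ncard = 2)
    (κ : DirichletCharacter ℂ (NumberField.discr K).natAbs)
    (hoddp : ∀ p : ℕ, p.Prime → p ≠ 2 → κ p = (jacobiSym (NumberField.discr K) p : ℂ)) :
    κ 2 = 1 ∧
      (κ 2 = if NumberField.discr K % 8 = 1 then 1
        else if NumberField.discr K % 8 = 5 then -1 else 0) := by
  have h81 : NumberField.discr K % 8 = 1 := (ncard_primesOver_two_eq_two_iff (K := K) h2).mp hsplit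
  have h4 : NumberField.discr K % 4 = 1 := by omega
  have h := kroneckerChar_two_of_discr_odd h4 κ hoddp
  rw [if_pos h81] at h
  exact ⟨h, by rw [h, if_pos h81]⟩

end Literature.NumberTheory.QuadraticFields

end
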